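import Summits.NavierStokesRegularity.NavierStokesRegularity.Theorems.ScenarioCensusTemporalSpectrumJordan
import Summits.NavierStokesRegularity.NavierStokesRegularity.Theorems.ScenarioCensusModeRankShell
import HarnessLib

/-!
# LINE «temporal-spectrum» port, part 6/12: §K finite complex simple spectrum (a) — sums, weighted groups, `trig_coeff_eq_zero`, the `cs` bookkeeping

Re-homed for the scenario census (typer seat ns-census-typer-1 g8; the cells A1ex / A1po are MEMBERS OF RECORD «DECIDED IN KERNEL IN FILES» of row A1apT since census
v1.69 and A1jb / A1cs / A1qx / A1cx since v1.71 (critic idea-crit-3 g6 PASS — no price 20:33:05Z, RE-STAMPs REV 2 → REV 3 → REV 4 22:13:50Z; ref ns-census-ref g8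
PRE-CHECK ✓ §13.14 item 11 + items 19/20; lit §21.21 / §21.24 (a)); this port makes them TREE-decided): VERBATIM PORT of ns-idea-2 LINE g12-2 «temporal-spectrum»
REV 4, `pub/ideators/ns-idea-2/lines/temporal-spectrum/line-temporal-spectrum.lean` sha16 f2331f3a0765e1d4 (3431 l., lean check rc 0, 0 sorry), split for the
400-line rule into twelve parts `ScenarioCensusTemporalSpectrum{∅, Exponential, Oscillatory, OscillatoryRow, Jordan, Complex, ComplexDecay, ComplexRow, Quasi, QuasiGroup,
QuasiRow, Head}` (chain imports).  Lean text VERBATIM in namespace `…Theorems.ScenarioCensus.TemporalSpectrum` (the line's `…Lines.TemporalSpectrum` re-homed);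
port edits: the two `local notation "E3"` lines → one `abbrev E3` at namespace level and the bracket lines `section Rows` / `end Rows` dropped (no `variable`s
there; typer lint: no notation in port files), `@[conjecture]` on the OPEN head `Row_A1qp` (typed only), twenty-one one-line docstrings added (gate lint); the
lemmas the line shares VERBATIM with «mode-rank» / «floquet-meter» (§B spatial Liouville lemmas, the instrument `vortB` / `vortB_sum_sum`, the gauge
`tendsto_slice_atBot` / `eq_zero_of_curl_slice_const`, `laplacian_zero_apply`, `norm_curl_le_four_mul`) are taken BY NAME from those landed ports (listed
below); `tendsto_typeI_bound` (twin of a landed tree lemma in a module the farm does not build) is not re-declared and its four uses carry the one-line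
Mathlib proof inline (proof text only).  Statements untouched.

No census VALUE is moved here (row A1apT keeps its value; the members become TREE-decided by name); NS regularity is NOT proved; (L′) ⟨10661⟩ is
untouched; no summit statement is proved by this file. Lemmas that restate already-landed tree declarations are taken BY NAME (gate lint `dedup.landed`): `apply_eq_apply_of_harmonic_bounded` = `ModeRank.apply_eq_apply_of_harmonic_bounded`, `apply_eq_apply_of_curl_const` = `ModeRank.apply_eq_apply_of_curl_const`, `nonpos_of_laplacian_eq_mul` = `ModeRank.nonpos_of_laplacian_eq_mul`, `eq_zero_of_laplacian_eq_smul_of_pos` = `ModeRank.eq_zero_of_laplacian_eq_smul_of_pos`, `vortB` = `ModeRank.vortB`, `vortB_sum_sum` = `ModeRank.vortB_sum_sum`, `tendsto_slice_atBot` = `ModeRank.tendsto_slice_atBot`, `eq_zero_of_curl_slice_const` = `ModeRank.eq_zero_of_curl_slice_const`, `laplacian_zero_apply` = `ModeRank.laplacian_zero_fun`, `norm_curl_le_four_mul` = `FloquetMeter.norm_curl_le_four_mul`.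
-/

-- the summit and its single problem share the name `NavierStokesRegularity` (D-0017 nested layout)
set_option linter.dupNamespace false

noncomputable section

open Set Function Filter Topology

namespace Summit.NavierStokesRegularity.NavierStokesRegularity.Theorems.ScenarioCensus.TemporalSpectrum

open Literature.Analysis Literature.Analysis.FluidPDE InnerProductSpace
open Summit.NavierStokesRegularity.NavierStokesRegularity.Theorems (vorticity_eq_deriv_of_typeI)
open scoped Laplacian InnerProductSpace RealInnerProductSpace ContDiff

/-! ## K. Finite COMPLEX SIMPLE temporal spectrum: several oscillatory pairs at once (REV 3)

`u(t,x) = ∑ₖ e^{aₖt}(cos(bₖt) ψₖ(x) + sin(bₖt) χₖ(x))` with distinct rates `aₖ + i bₖ`, `bₖ ≥ 0`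
(real rates are the modes with `bₖ = 0`).  The lever of §A–§D verbatim, with (1) replaced by DOMINANT
BALANCE BY REAL PART with bounded trigonometric factors (`tendsto_group_of_weighted`) followed by the
INDEPENDENCE OF FINITELY MANY FREQUENCIES at `-∞` (`trig_coeff_eq_zero`: the second-order difference
`f(t+τ) + f(t-τ) - 2cos(βτ) f(t)` deletes the frequency `β` and rescales every other frequency `γ` by
`2(cos γτ - cos βτ) ≠ 0` for small `τ`; induction on the number of frequencies), and with the positive
shell replaced by the rotating shell system of §H at the smallest vorticity-carrying real part. -/

/-- Curl of a finite linear combination (arbitrary finite index type). -/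
theorem curl_sum_smul' {ι : Type*} [Fintype ι] {φ : ι → E3 → E3}
    (hφ : ∀ k, Differentiable ℝ (φ k)) (c : ι → ℝ) (x : E3) :
    curl (fun y => ∑ k, c k • φ k y) x = ∑ k, c k • curl (φ k) x := by
  classical
  suffices h : ∀ s : Finset ι,
      curl (fun y => ∑ k ∈ s, c k • φ k y) x = ∑ k ∈ s, c k • curl (φ k) x from h Finset.univ
  intro s
  induction s using Finset.induction_on with
  | empty => simp
  | insert a s ha IH =>
    have h1 : (fun y => ∑ k ∈ insert a s, c k • φ k y)
        = fun y => c a • φ a y + ∑ k ∈ s, c k • φ k y := by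
      funext y; simp [Finset.sum_insert ha]
    have hd1 : DifferentiableAt ℝ (fun y => c a • φ a y) x := ((hφ a) x).const_smul (c a)
    have hd2 : DifferentiableAt ℝ (fun y => ∑ k ∈ s, c k • φ k y) x :=
      DifferentiableAt.fun_sum fun k _ => ((hφ k) x).const_smul (c k)
    rw [h1, curl_add hd1 hd2, IH, Finset.sum_insert ha, curl_const_smul ((hφ a) x) (c a)]

/-- Laplacian of a finite linear combination of `C²` fields (arbitrary finite index type). -/
theorem laplacian_sum_smul' {ι : Type*} [Fintype ι] {w : ι → E3 → E3}
    (hw : ∀ k, ContDiff ℝ 2 (w k)) (c : ι → ℝ) (x : E3) :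
    (Δ (fun y => ∑ k, c k • w k y)) x = ∑ k, c k • (Δ (w k)) x := by
  classical
  suffices h : ∀ s : Finset ι,
      (Δ (fun y => ∑ k ∈ s, c k • w k y)) x = ∑ k ∈ s, c k • (Δ (w k)) x from h Finset.univ
  intro s
  induction s using Finset.induction_on with
  | empty =>
    have h0 : (fun y : E3 => ∑ k ∈ (∅ : Finset ι), c k • w k y) = (0 : E3 → E3) := by
      funext y; simp
    have h := InnerProductSpace.laplacian_smul (𝕜 := ℝ) (f := (0 : E3 → E3)) (x := x) (0 : ℝ)
      contDiffAt_const
    rw [h0, Finset.sum_empty]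
    simpa using h
  | insert a s ha IH =>
    have h1 : (fun y => ∑ k ∈ insert a s, c k • w k y)
        = (c a • w a) + fun y => ∑ k ∈ s, c k • w k y := by
      funext y; simp [Finset.sum_insert ha]
    have hc1 : ContDiffAt ℝ 2 (c a • w a) x := ((hw a).const_smul (c a)).contDiffAt
    have hc2 : ContDiffAt ℝ 2 (fun y => ∑ k ∈ s, c k • w k y) x :=
      (ContDiff.sum fun k _ => (hw k).const_smul (c k)).contDiffAt
    rw [h1, hc1.laplacian_add hc2, IH, Finset.sum_insert ha,
      InnerProductSpace.laplacian_smul (c a) (hw a).contDiffAt]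

/-- Time derivative of a finite mode sum (arbitrary finite index type). -/
theorem hasDerivAt_sum_smul' {ι : Type*} [Fintype ι] {c : ℝ → ι → ℝ} {c' : ι → ℝ} (v : ι → E3)
    {t : ℝ} (hc : ∀ k, HasDerivAt (fun s => c s k) (c' k) t) :
    HasDerivAt (fun s => ∑ k, c s k • v k) (∑ k, c' k • v k) t :=
  HasDerivAt.fun_sum fun k _ => (hc k).smul_const (v k)

/-- **Dominant balance by real part, with bounded factors.**  If the weighted sum
`e^{-rt} ∑ᵢ e^{νᵢ t} gᵢ(t)` tends to `0` at `-∞`, every `gᵢ` is bounded, and the terms of rate `< r`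
vanish identically, then the rate-`r` group `∑_{νᵢ = r} gᵢ(t)` tends to `0` at `-∞`. -/
theorem tendsto_group_of_weighted {ι : Type*} [Fintype ι] (ν : ι → ℝ) (g : ι → ℝ → E3)
    (hb : ∀ i, ∃ M : ℝ, ∀ t, ‖g i t‖ ≤ M) (r : ℝ) (hzero : ∀ i, ν i < r → ∀ t, g i t = 0)
    (h : Tendsto (fun t : ℝ => Real.exp (-(r * t)) • ∑ i, Real.exp (ν i * t) • g i t)
      atBot (𝓝 0)) :
    Tendsto (fun t : ℝ => ∑ i ∈ Finset.univ.filter (fun i => ν i = r), g i t) atBot (𝓝 0) := by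
  classical
  -- the weighted sum, termwise
  have h' : Tendsto (fun t : ℝ => ∑ i, Real.exp ((ν i - r) * t) • g i t) atBot (𝓝 0) := by
    refine h.congr fun t => ?_
    rw [Finset.smul_sum]
    refine Finset.sum_congr rfl fun i _ => ?_
    rw [smul_smul, ← Real.exp_add]
    congr 1; congr 1; ring
  -- the off-group remainder tends to zero
  have hR : Tendsto (fun t : ℝ => ∑ i ∈ Finset.univ.filter (fun i => ¬ ν i = r),
      Real.exp ((ν i - r) * t) • g i t) atBot (𝓝 0) := by
    rw [show (0 : E3) = ∑ i ∈ Finset.univ.filter (fun i => ¬ ν i = r), (0 : E3) by simp]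
    refine tendsto_finsetSum _ fun i hi => ?_
    rw [Finset.mem_filter] at hi
    rcases lt_or_gt_of_ne hi.2 with hlt | hgt
    · refine tendsto_const_nhds.congr fun t => ?_
      rw [hzero i hlt t, smul_zero]
    · obtain ⟨M, hM⟩ := hb i
      have he : Tendsto (fun t : ℝ => Real.exp ((ν i - r) * t)) atBot (𝓝 0) :=
        Real.tendsto_exp_atBot.comp (tendsto_id.const_mul_atBot (sub_pos.2 hgt))
      have heM : Tendsto (fun t : ℝ => Real.exp ((ν i - r) * t) * M) atBot (𝓝 0) := by
        simpa using he.mul_const M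
      refine squeeze_zero_norm' (Eventually.of_forall fun t => ?_) heM
      rw [norm_smul, Real.norm_of_nonneg (Real.exp_pos _).le]
      exact mul_le_mul_of_nonneg_left (hM t) (Real.exp_pos _).le
  have hsplit : ∀ t : ℝ, ∑ i ∈ Finset.univ.filter (fun i => ν i = r), g i t
      = ∑ i, Real.exp ((ν i - r) * t) • g i t
        - ∑ i ∈ Finset.univ.filter (fun i => ¬ ν i = r), Real.exp ((ν i - r) * t) • g i t := by
    intro t
    rw [← Finset.sum_filter_add_sum_filter_not Finset.univ (fun i => ν i = r), add_sub_cancel_right]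
    refine Finset.sum_congr rfl fun i hi => ?_
    rw [Finset.mem_filter] at hi
    rw [hi.2, sub_self, zero_mul, Real.exp_zero, one_smul]
  have := h'.sub hR
  rw [sub_zero] at this
  exact this.congr fun t => (hsplit t).symm

/-- The second-order difference with step `τ` and reference frequency (through `c = 2cos(βτ)`) acts
diagonally on a trigonometric mode of frequency `b`. -/
theorem dTau_term (b τ c t : ℝ) (X Y : E3) :
    Real.cos (b * (t + τ)) • X + Real.sin (b * (t + τ)) • Y
      + (Real.cos (b * (t - τ)) • X + Real.sin (b * (t - τ)) • Y)
      - c • (Real.cos (b * t) • X + Real.sin (b * t) • Y)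
    = Real.cos (b * t) • ((2 * Real.cos (b * τ) - c) • X)
      + Real.sin (b * t) • ((2 * Real.cos (b * τ) - c) • Y) := by
  simp only [mul_add, mul_sub, Real.cos_add, Real.cos_sub, Real.sin_add, Real.sin_sub]
  module

/-- A vector that is the value of a function tending to zero at arbitrarily early times is zero. -/
theorem eq_zero_of_frequently_eq {f : ℝ → E3} (hf : Tendsto f atBot (𝓝 0)) {X : E3}
    (hX : ∀ T : ℝ, ∃ s ≤ T, f s = X) : X = 0 := by
  by_contra hne
  have hε : 0 < ‖X‖ := norm_pos_iff.2 hne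
  have h := hf
  rw [tendsto_zero_iff_norm_tendsto_zero] at h
  obtain ⟨T, hT⟩ := eventually_atBot.1 (h.eventually (gt_mem_nhds hε))
  obtain ⟨s, hs, hfs⟩ := hX T
  have := hT s hs
  rw [hfs] at this
  exact lt_irrefl _ this

/-- **Independence of finitely many frequencies at `-∞`.**  If a trigonometric sum
`∑ᵢ (cos(βᵢt) Xᵢ + sin(βᵢt) Yᵢ)` with distinct frequencies `βᵢ ≥ 0` tends to `0` as `t → -∞`, then
every `Xᵢ` vanishes, and every `Yᵢ` with `βᵢ ≠ 0` vanishes. -/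
theorem trig_coeff_eq_zero {ι : Type*} (s : Finset ι) :
    ∀ (β : ι → ℝ) (X Y : ι → E3), (∀ i ∈ s, 0 ≤ β i) → Set.InjOn β s →
      Tendsto (fun t : ℝ => ∑ i ∈ s, (Real.cos (β i * t) • X i + Real.sin (β i * t) • Y i))
        atBot (𝓝 0) →
      ∀ i ∈ s, X i = 0 ∧ (β i ≠ 0 → Y i = 0) := by
  classical
  induction s using Finset.induction_on with
  | empty => intro β X Y _ _ _ i hi; simp at hi
  | insert j s hj IH =>
    intro β X Y hβ hinj hlim
    -- a small step `τ` with all `βᵢ τ ∈ [0, π/2]`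
    set B : ℝ := ∑ i ∈ insert j s, β i with hB
    have hB0 : 0 ≤ B := Finset.sum_nonneg hβ
    set τ : ℝ := Real.pi / (2 * (1 + B)) with hτ
    have hτpos : 0 < τ := by rw [hτ]; positivity
    have hrange : ∀ i ∈ insert j s, β i * τ ∈ Icc 0 Real.pi := by
      intro i hi
      have hle : β i ≤ B := Finset.single_le_sum hβ hi
      refine ⟨mul_nonneg (hβ i hi) hτpos.le, ?_⟩
      rw [hτ]
      rw [mul_div_assoc']
      rw [div_le_iff₀ (by positivity)]
      nlinarith [Real.pi_pos, hβ i hi]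
    have hneq : ∀ i ∈ s, 2 * Real.cos (β i * τ) - 2 * Real.cos (β j * τ) ≠ 0 := by
      intro i hi hzero
      have hcos : Real.cos (β i * τ) = Real.cos (β j * τ) := by linarith
      have h1 := Real.injOn_cos (hrange i (Finset.mem_insert_of_mem hi))
        (hrange j (Finset.mem_insert_self j s)) hcos
      have h2 : β i = β j := mul_right_cancel₀ hτpos.ne' h1
      have h3 : i = j := hinj (Finset.mem_insert_of_mem hi) (Finset.mem_insert_self j s) h2
      exact hj (h3 ▸ hi)
    -- the second-order difference of the sum
    set c : ℝ := 2 * Real.cos (β j * τ) with hc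
    set f : ℝ → E3 := fun t => ∑ i ∈ insert j s,
      (Real.cos (β i * t) • X i + Real.sin (β i * t) • Y i) with hf
    have hD : Tendsto (fun t => f (t + τ) + f (t - τ) - c • f t) atBot (𝓝 0) := by
      have h1 : Tendsto (fun t => f (t + τ)) atBot (𝓝 0) :=
        hlim.comp (tendsto_atBot_add_const_right _ _ tendsto_id)
      have h2 : Tendsto (fun t => f (t - τ)) atBot (𝓝 0) :=
        (hlim.comp (tendsto_atBot_add_const_right _ (-τ) tendsto_id)).congr fun t => by
          simp only [Function.comp_apply, id, ← sub_eq_add_neg]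
      have h3 : Tendsto (fun t => c • f t) atBot (𝓝 0) := by
        simpa using hlim.const_smul c
      simpa using (h1.add h2).sub h3
    have hDform : ∀ t, f (t + τ) + f (t - τ) - c • f t
        = ∑ i ∈ s, (Real.cos (β i * t) • ((2 * Real.cos (β i * τ) - c) • X i)
          + Real.sin (β i * t) • ((2 * Real.cos (β i * τ) - c) • Y i)) := by
      intro t
      have h1 : f (t + τ) + f (t - τ) - c • f t
          = ∑ i ∈ insert j s, (Real.cos (β i * t) • ((2 * Real.cos (β i * τ) - c) • X i)
            + Real.sin (β i * t) • ((2 * Real.cos (β i * τ) - c) • Y i)) := by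
        simp only [hf, Finset.smul_sum, ← Finset.sum_add_distrib, ← Finset.sum_sub_distrib]
        exact Finset.sum_congr rfl fun i _ => dTau_term (β i) τ c t (X i) (Y i)
      rw [h1, Finset.sum_insert hj, hc]
      simp
    have hlim' : Tendsto (fun t : ℝ => ∑ i ∈ s,
        (Real.cos (β i * t) • ((2 * Real.cos (β i * τ) - c) • X i)
          + Real.sin (β i * t) • ((2 * Real.cos (β i * τ) - c) • Y i))) atBot (𝓝 0) :=
      hD.congr hDform
    have IH' := IH β (fun i => (2 * Real.cos (β i * τ) - c) • X i)
      (fun i => (2 * Real.cos (β i * τ) - c) • Y i)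
      (fun i hi => hβ i (Finset.mem_insert_of_mem hi))
      (hinj.mono (Finset.subset_insert j s)) hlim'
    -- the old frequencies
    have hold : ∀ i ∈ s, X i = 0 ∧ (β i ≠ 0 → Y i = 0) := by
      intro i hi
      obtain ⟨h1, h2⟩ := IH' i hi
      refine ⟨(smul_eq_zero.1 h1).resolve_left (hneq i hi), fun hb => ?_⟩
      exact (smul_eq_zero.1 (h2 hb)).resolve_left (hneq i hi)
    -- the new frequency
    have hsingle : Tendsto (fun t : ℝ => Real.cos (β j * t) • X j + Real.sin (β j * t) • Y j)
        atBot (𝓝 0) := by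
      refine hlim.congr fun t => ?_
      simp only [hf]
      rw [Finset.sum_insert hj, add_eq_left]
      refine Finset.sum_eq_zero fun i hi => ?_
      obtain ⟨h1, h2⟩ := hold i hi
      by_cases hb : β i = 0
      · simp [h1, hb]
      · simp [h1, h2 hb]
    have hnew : X j = 0 ∧ (β j ≠ 0 → Y j = 0) := by
      by_cases hbj : β j = 0
      · refine ⟨?_, fun h => (h hbj).elim⟩
        have : Tendsto (fun _ : ℝ => X j) atBot (𝓝 0) := by
          refine hsingle.congr fun t => ?_
          simp [hbj]
        exact tendsto_nhds_unique tendsto_const_nhds this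
      · have hbpos : 0 < β j := lt_of_le_of_ne (hβ j (Finset.mem_insert_self j s)) (Ne.symm hbj)
        refine ⟨eq_zero_of_frequently_eq hsingle fun T => ?_,
          fun _ => ?_⟩
        · obtain ⟨s0, hs0, -, hc1, hs1⟩ := exists_le_cos_eq_one hbpos T
          exact ⟨s0, hs0, by rw [hc1, hs1, one_smul, zero_smul, add_zero]⟩
        · have hY : -Y j = 0 := by
            refine eq_zero_of_frequently_eq hsingle fun T => ?_
            obtain ⟨s0, hs0, -, hc0, hs1⟩ := exists_le_sin_eq_neg_one hbpos T
            exact ⟨s0, hs0, by rw [hc0, hs1, zero_smul, zero_add, neg_one_smul]⟩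
          exact neg_eq_zero.1 hY
    intro i hi
    rcases Finset.mem_insert.1 hi with rfl | hi'
    · exact hnew
    · exact hold i hi'

-- `laplacian_zero_apply`: the line restates the tree's `ModeRank.laplacian_zero_fun`; taken BY NAME (gate lint dedup.landed).

/-- Group sums over the doubled index `Fin n ⊕ Fin n` (cosine modes ⊕ sine modes, equal rates)
collapse to sums over `Fin n`. -/
theorem sum_filter_sumType {n : ℕ} (a : Fin n → ℝ) (r : ℝ) (H : Fin n ⊕ Fin n → E3) :
    ∑ m ∈ Finset.univ.filter (fun m : Fin n ⊕ Fin n => Sum.elim a a m = r), H m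
      = ∑ k ∈ Finset.univ.filter (fun k => a k = r), (H (Sum.inl k) + H (Sum.inr k)) := by
  classical
  rw [Finset.sum_filter, Fintype.sum_sum_type, Finset.sum_filter, ← Finset.sum_add_distrib]
  refine Finset.sum_congr rfl fun k _ => ?_
  simp only [Sum.elim_inl, Sum.elim_inr]
  split_ifs <;> simp

/-- The doubled mode family of the complex-simple ansatz: `inl k ↦ ψₖ` (cosine), `inr k ↦ χₖ` (sine). -/
def csΦ {n : ℕ} (ψ χ : Fin n → E3 → E3) : Fin n ⊕ Fin n → E3 → E3 := Sum.elim ψ χ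
/-- Real parts of the rates on the doubled index. -/
def csν {n : ℕ} (a : Fin n → ℝ) : Fin n ⊕ Fin n → ℝ := Sum.elim a a
/-- Trigonometric factors `cos(bₖ s)` / `sin(bₖ s)` on the doubled index. -/
def csT {n : ℕ} (b : Fin n → ℝ) (s : ℝ) : Fin n ⊕ Fin n → ℝ :=
  Sum.elim (fun k => Real.cos (b k * s)) (fun k => Real.sin (b k * s))
/-- Their time derivatives. -/
def csD {n : ℕ} (b : Fin n → ℝ) (s : ℝ) : Fin n ⊕ Fin n → ℝ :=
  Sum.elim (fun k => -(Real.sin (b k * s) * b k)) (fun k => Real.cos (b k * s) * b k)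

/-- `csΦ` on the left summand. -/
@[simp] theorem csΦ_inl {n : ℕ} (ψ χ : Fin n → E3 → E3) (k : Fin n) : csΦ ψ χ (Sum.inl k) = ψ k := rfl
/-- `csΦ` on the right summand. -/
@[simp] theorem csΦ_inr {n : ℕ} (ψ χ : Fin n → E3 → E3) (k : Fin n) : csΦ ψ χ (Sum.inr k) = χ k := rfl
/-- `csν` on the left summand. -/
@[simp] theorem csν_inl {n : ℕ} (a : Fin n → ℝ) (k : Fin n) : csν a (Sum.inl k) = a k := rfl
/-- `csν` on the right summand. -/
@[simp] theorem csν_inr {n : ℕ} (a : Fin n → ℝ) (k : Fin n) : csν a (Sum.inr k) = a k := rfl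
/-- `csT` on the left summand. -/
@[simp] theorem csT_inl {n : ℕ} (b : Fin n → ℝ) (s : ℝ) (k : Fin n) :
    csT b s (Sum.inl k) = Real.cos (b k * s) := rfl
/-- `csT` on the right summand. -/
@[simp] theorem csT_inr {n : ℕ} (b : Fin n → ℝ) (s : ℝ) (k : Fin n) :
    csT b s (Sum.inr k) = Real.sin (b k * s) := rfl
/-- `csD` on the left summand. -/
@[simp] theorem csD_inl {n : ℕ} (b : Fin n → ℝ) (s : ℝ) (k : Fin n) :
    csD b s (Sum.inl k) = -(Real.sin (b k * s) * b k) := rfl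
/-- `csD` on the right summand. -/
@[simp] theorem csD_inr {n : ℕ} (b : Fin n → ℝ) (s : ℝ) (k : Fin n) :
    csD b s (Sum.inr k) = Real.cos (b k * s) * b k := rfl

/-- `|csT| ≤ 1`. -/
theorem abs_csT_le {n : ℕ} (b : Fin n → ℝ) (s : ℝ) (m : Fin n ⊕ Fin n) : |csT b s m| ≤ 1 := by
  rcases m with k | k
  · exact Real.abs_cos_le_one _
  · exact Real.abs_sin_le_one _

/-- Bound on `|csD|`. -/
theorem abs_csD_le {n : ℕ} (b : Fin n → ℝ) (s : ℝ) (m : Fin n ⊕ Fin n) :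
    |csD b s m| ≤ |Sum.elim b b m| := by
  rcases m with k | k
  · simp only [csD_inl, Sum.elim_inl, abs_neg, abs_mul]
    exact mul_le_of_le_one_left (abs_nonneg _) (Real.abs_sin_le_one _)
  · simp only [csD_inr, Sum.elim_inr, abs_mul]
    exact mul_le_of_le_one_left (abs_nonneg _) (Real.abs_cos_le_one _)

/-- Time derivative of the coefficient `e^{ν s}·trig(s)` of a mode of the complex-simple ansatz. -/
theorem hasDerivAt_csCoeff {n : ℕ} (a b : Fin n → ℝ) (m : Fin n ⊕ Fin n) (t : ℝ) :
    HasDerivAt (fun s => Real.exp (csν a m * s) * csT b s m)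
      (Real.exp (csν a m * t) * (csν a m * csT b t m + csD b t m)) t := by
  rcases m with k | k
  · have he : HasDerivAt (fun s => Real.exp (a k * s)) (Real.exp (a k * t) * a k) t := by
      have h1 : HasDerivAt (fun s => a k * s) (a k) t := by
        simpa using (hasDerivAt_id t).const_mul (a k)
      simpa using h1.exp
    have hb1 : HasDerivAt (fun s => b k * s) (b k) t := by
      simpa using (hasDerivAt_id t).const_mul (b k)
    have hcos : HasDerivAt (fun s => Real.cos (b k * s)) (-Real.sin (b k * t) * b k) t := hb1.cos
    simp only [csν_inl, csT_inl, csD_inl]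
    exact (he.fun_mul hcos).congr_deriv (by ring)
  · have he : HasDerivAt (fun s => Real.exp (a k * s)) (Real.exp (a k * t) * a k) t := by
      have h1 : HasDerivAt (fun s => a k * s) (a k) t := by
        simpa using (hasDerivAt_id t).const_mul (a k)
      simpa using h1.exp
    have hb1 : HasDerivAt (fun s => b k * s) (b k) t := by
      simpa using (hasDerivAt_id t).const_mul (b k)
    have hsin : HasDerivAt (fun s => Real.sin (b k * s)) (Real.cos (b k * t) * b k) t := hb1.sin
    simp only [csν_inr, csT_inr, csD_inr]
    exact (he.fun_mul hsin).congr_deriv (by ring)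

end Summit.NavierStokesRegularity.NavierStokesRegularity.Theorems.ScenarioCensus.TemporalSpectrum

end
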